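import Literature.Algebra.EuclideanLattices.MRGapCVPWitness
import Literature.Probability.Distributions.IndepProductLawMeasure
import HarnessLib

/-!
# MR07 Thm. 5.23, eqs. (16)–(18) for one witness sample, read at the `PMF` level — proved

Topic `Algebra/EuclideanLattices` (family `pqc`). Theorems only. Companion of `MRGapCVPWitness.lean`,
which proves the three per-sample bounds of the NO case of Micciancio–Regev 2007, Thm. 5.23 (authors'
version pp. 30–31) for the witness sample `w = e − ∑ᵢ zᵢ(yᵢ − cᵢ)` with independent
`yᵢ ∼ D_{Λ,s,cᵢ}` on an abstract probability space. For the `PMF`-level (machine) assembly the `yᵢ`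
are the coordinates of the product law `⨂ᵢ D_{Λ,s,cᵢ} = indepLaw m (i ↦ discreteGaussian Λ s (cᵢ))`
(bridge `IndepProductLawMeasure.lean`); this file restates the three bounds for that law:

* `toReal_indepLaw_le_norm_witness_le` — eq. (17): `Pr[√(nm)·2sβ ≤ ‖w‖] ≤ m (1+ε)/(1−ε) 2⁻ⁿ`;
* `integral_indepLaw_inner_witness_sq_le` — eq. (18): `E⟨u, w⟩² ≤ (2sβ)²` for unit `u`;
* `integral_indepLaw_cos_witness_le` — eq. (16): `E cos(2π⟨t, w⟩) ≤ 2·2⁻ⁿ` on the dual lattice of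
  `L` when `dist(−zⱼt, L) > g`, `zⱼ ≠ 0`, `s = 2√n/g`.

## References

* D. Micciancio, O. Regev, *Worst-case to average-case reductions based on Gaussian measures*,
  SIAM J. Comput. 37 (2007) 267–302; authors' version, proof of Thm. 5.23, eqs. (16)–(18), pp. 30–31.
-/

noncomputable section

open MeasureTheory ProbabilityTheory Module Metric Finset
open scoped Real InnerProductSpace ENNReal

namespace Literature.Algebra.EuclideanLattices

namespace MicciancioRegev2007

open Literature.Probability.Distributions

variable {V : Type*} [NormedAddCommGroup V] [InnerProductSpace ℝ V] [FiniteDimensional ℝ V]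
  [MeasurableSpace V] [BorelSpace V]
variable (Λ : Submodule ℤ V) [DiscreteTopology Λ] [IsZLattice ℝ Λ]
variable {m : ℕ}

/-- **MR07 eq. (17), `PMF` form**: for `y ∼ ⨂ᵢ D_{Λ,s,cᵢ}` (`0 < ε < 1`, `0 < s`, `η_ε(Λ) ≤ s`),
`‖e‖ < sβ`, `∑ zᵢ² ≤ β²`, `1 ≤ n m`:
`Pr[√(nm)·(2sβ) ≤ ‖e − ∑ᵢ zᵢ(yᵢ − cᵢ)‖] ≤ m · (1+ε)/(1−ε) · 2⁻ⁿ`.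
[cite: MicciancioRegev2007, Thm. 5.23 (proof, p. 31, eq. (17))] -/
theorem toReal_indepLaw_le_norm_witness_le {ε s β : ℝ} (hε : 0 < ε) (hε1 : ε < 1) (hs : 0 < s)
    (hηs : smoothingParameter Λ ε ≤ s) (c : Fin m → V) {e : V} (he : ‖e‖ < s * β)
    {z : Fin m → ℤ} (hz : ∑ i, (z i : ℝ) ^ 2 ≤ β ^ 2) (hnm : 1 ≤ finrank ℝ V * m) :
    ((indepLaw m fun i => discreteGaussian Λ s (c i)).toOuterMeasure
        {y | Real.sqrt (finrank ℝ V * m) * (2 * s * β) ≤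
          ‖e - ∑ i, (z i : ℝ) • ((y i : V) - c i)‖}).toReal ≤
      m * ((1 + ε) / (1 - ε) * (2⁻¹ : ℝ) ^ finrank ℝ V) := by
  set p : Fin m → PMF Λ := fun i => discreteGaussian Λ s (c i) with hp
  have h := measureReal_le_norm_witness_le_of_lt Λ hε hε1 hs hηs c
    (fun i => hasLaw_eval_indepLaw m p i) he hz hnm
  rwa [measureReal_indepLaw_eq_toReal] at h

/-- **MR07 eq. (18) with (19), (20), `PMF` form**: for `y ∼ ⨂ᵢ D_{Λ,s,cᵢ}` (`0 < ε < 1`, `0 < s`,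
`2η_ε(Λ) ≤ s`), `‖e‖ ≤ sβ`, `∑ zᵢ² ≤ β²`, the side condition `1/(2π) + ε/(1−ε) + (ε/(1−ε))² m ≤ 1`,
and a unit vector `u`: `E⟨u, e − ∑ᵢ zᵢ(yᵢ − cᵢ)⟩² ≤ (2sβ)²`.
[cite: MicciancioRegev2007, Thm. 5.23 (proof, p. 31, eqs. (18)–(20))] -/
theorem integral_indepLaw_inner_witness_sq_le_sq {ε s β : ℝ} (hε : 0 < ε) (hε1 : ε < 1) (hs : 0 < s)
    (hηs : 2 * smoothingParameter Λ ε ≤ s) (c : Fin m → V) {e : V} (he : ‖e‖ ≤ s * β)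
    {z : Fin m → ℤ} (hz : ∑ i, (z i : ℝ) ^ 2 ≤ β ^ 2)
    (hnum : 1 / (2 * π) + ε / (1 - ε) + (ε / (1 - ε)) ^ 2 * m ≤ 1) {u : V} (hu : ‖u‖ = 1) :
    ∫ y, ⟪u, e - ∑ i, (z i : ℝ) • ((y i : V) - c i)⟫_ℝ ^ 2
        ∂(indepLaw m fun i => discreteGaussian Λ s (c i)).toMeasure ≤ (2 * s * β) ^ 2 := by
  set p : Fin m → PMF Λ := fun i => discreteGaussian Λ s (c i) with hp
  exact integral_inner_witness_sq_le_sq Λ hε hε1 hs hηs c (fun i => measurable_pi_apply i)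
    (iIndepFun_eval_indepLaw m p) (fun i => hasLaw_eval_indepLaw m p i) he hz hnum hu

/-- **MR07 eq. (16), `PMF` form**: let `L` be a full-rank lattice, `n = dim V ≥ 2`, `0 < g < λ₁(L)`,
`y ∼ ⨂ᵢ D_{L*,s,cᵢ}` on the dual lattice with `s = 2√n/g`, and `j` with `zⱼ ≠ 0`,
`dist(−zⱼ t, L) > g`. Then `E cos(2π⟨t, e − ∑ᵢ zᵢ(yᵢ − cᵢ)⟩) ≤ 2 · 2⁻ⁿ`.
[cite: MicciancioRegev2007, Thm. 5.23 (proof, p. 30, eq. (16))] -/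
theorem integral_indepLaw_cos_witness_le (L : Submodule ℤ V) [DiscreteTopology L] [IsZLattice ℝ L]
    (hn : 2 ≤ finrank ℝ V) {g : ℝ} (hg : 0 < g) (hgL : g < minNorm L) (c : Fin m → V) {j : Fin m}
    (e t : V) {z : Fin m → ℤ} (hzj : z j ≠ 0)
    (hfar : g < infDist (((-z j : ℤ) : ℝ) • t) (L : Set V)) :
    ∫ y, Real.cos (2 * π * ⟪t, e - ∑ i, (z i : ℝ) • ((y i : V) - c i)⟫_ℝ)
        ∂(indepLaw m fun i => discreteGaussian (dualLattice L)
          (2 * Real.sqrt (finrank ℝ V) / g) (c i)).toMeasure ≤ 2 * (2⁻¹ : ℝ) ^ finrank ℝ V := by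
  set p : Fin m → PMF (dualLattice L) := fun i =>
    discreteGaussian (dualLattice L) (2 * Real.sqrt (finrank ℝ V) / g) (c i) with hp
  exact integral_cos_witness_le (P := (indepLaw m p).toMeasure) L hn hg hgL c
    (fun i => measurable_pi_apply i) (iIndepFun_eval_indepLaw m p) (hasLaw_eval_indepLaw m p j)
    e t hzj hfar

end MicciancioRegev2007

end Literature.Algebra.EuclideanLattices

end
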